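import Mathlib.Analysis.Normed.Group.AddCircle
import Mathlib.Analysis.SpecialFunctions.Log.Basic
import Mathlib.MeasureTheory.Function.LpSeminorm.Basic
import Literature.Analysis.FluidPDE.VectorCalculus
import HarnessLib

/-!
# Kinetic-energy lower bound for vorticity concentrated near a closed curve (Jerrard–Seis)

Analysis/FluidPDE named-fact file. Source: R. L. Jerrard, C. Seis, *On the vortex filament
conjecture for Euler flows*, Arch. Ration. Mech. Anal. 224 (2017) 135–172 = arXiv:1603.00227
[JerrardSeis2016]. Locators (section, equation and page numbers) follow the arXiv PDF: §2.1
"Notation", pp. 3–4 (security radius `r_γ` (1), `κ* = 1/r_γ` (2), the weak-`L¹` quantity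
`‖κ*‖_{L^{1,∞}}` (4), the vector-valued measure `μ_Γ` (display on p. 4), the homogeneous flat norm
`‖·‖_F` (5)); §2.4 "Main results", pp. 7–8 (concentration hypothesis (12), the energy lower bound
(13), the time-rescaling factor `k_ε = 4π/|log(ε/L)|` (display after (13)), the excess
`Exc_ε(u, Λ)` (14), Theorem 1 on p. 8); §4.3 "Proof of Theorem 1", p. 23.

## What is vendored

For a velocity field `u ∈ L²(ℝ³; ℝ³)` with `∇·u = 0` distributionally whose vorticity is
`ε`-concentrated, in the homogeneous flat norm, around a closed Lipschitz curve `Γ` of length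
`L` with arclength parametrisation `γ : ℝ/Lℤ → ℝ³`,
`‖∇ × u − μ_Γ‖_F ≤ ε L` (their (12)), Theorem 1 (first assertion) states
`0 ≤ Exc_ε(u, Γ) + O(‖κ*‖²_{L^{1,∞}} k_ε)` with an absolute implicit constant (§2.1: "the
implicit constants are absolute in the sense that they are independent of all parameters"),
where `Exc_ε(u, Γ) = (k_ε/L) ∫ ½|u|² − 1`. Unwinding `k_ε = 4π/log(L/ε)` this is the kinetic
energy lower bound (13)
`∫ ½|u|² ≥ L log(L/ε)/(4π) − C ‖κ*‖²_{L^{1,∞}} L`,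
which is the form recorded in `JerrardSeis2016_filamentEnergyLowerBound` (the two forms are
equivalent by elementary algebra: `filamentEnergyLowerBound_iff_excess`).

The file defines the vocabulary needed to state it faithfully, all parametrisation-based as in
the source (`μ_Γ` is defined through `γ`, §2.1):
* `IsArclengthLoop L γ` — `γ : ℝ → ℝ³` is an arclength parametrisation of a closed oriented
  Lipschitz curve of length `L`: `L`-periodic, `1`-Lipschitz, `|γ'| = 1` a.e.;
* `loopDist L h = ‖(h : ℝ/Lℤ)‖ = min_k |h − kL|` (the source's `|s − t|` "distance modulo `Lℤ`");
* `securityRadii`, `securityRadius` (`r_γ(s)`, valued in `[0, ∞]`), `kappaStar` (`κ* = 1/r_γ`),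
  `weakL1Norm` (`sup_{σ>0} σ |{s ∈ ℝ/Lℤ : κ*(s) ≥ σ}|`);
* `tangentLineIntegral L γ ξ = ∫ ξ · dμ_Γ = ∫_{ℝ/Lℤ} ξ(γ(s)) · γ'(s) ds`;
* `IsFlatConcentrated L γ u δ` — `‖∇ × u − μ_Γ‖_F ≤ δ`, written out through the definition of
  the flat norm (`sup` over `ξ ∈ C¹_c(ℝ³;ℝ³)` with `‖∇ × ξ‖_∞ ≤ 1` of `∫ ξ · d(∇ × u − μ_Γ)`, the
  distribution `∇ × u` of `u ∈ L²` being paired as `∫ u · ∇ × ξ`), and `vorticityFlatDist`, the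
  flat distance itself, with `isFlatConcentrated_iff`;
* `timeRescaling L ε = k_ε`, `excess L ε u = Exc_ε(u, Γ)`.

## Design notes

* `r_γ(s)` is the supremum of the admissible radii, taken in `ℝ≥0∞` (`⨆` of `ENNReal.ofReal`),
  so that `sup ∅ = 0` (no admissible radius, e.g. at a corner) and `κ* = r⁻¹` uses the `ℝ≥0∞`
  conventions `0⁻¹ = ∞`, `∞⁻¹ = 0`; no real-valued junk enters `‖κ*‖_{L^{1,∞}}`. As in the source,
  `r_γ(s) = 0` where `γ` is not differentiable; inside the admissibility conditions `γ'` is Lean's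
  `deriv γ` (value `0` at the null set of non-differentiability points of the Lipschitz map `γ`;
  a non-differentiability point at loop distance `d` from `s` therefore caps `r_γ(s)` at `d` when
  `|γ'(s)| = 1`, exactly as a corner does in the source, cf. §2.1 "allows corners (but not cusps)").
* `|γ'(s)| = 1` is required almost everywhere: for a Lipschitz curve `γ'` exists only a.e.
  (§4.1: "`r_γ(s) > 0` a.e. for any arclength parametrization").
* The weak-`L¹` quantity is the source's `sup_{σ>0} σ |{κ* ≥ σ}|` over one period `[0, L)`
  (including `σ = 0` is harmless: `0 · m = 0` in `ℝ≥0∞`).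
* Deliberately NOT here: the second assertion of Theorem 1 (the distributional estimate
  (16) against `∫_Γ φ : (I − τ ⊗ τ) dH¹`), Theorem 2 (closeness to the binormal curvature
  flow), and any periodic (`T³`) variant — the source works on `ℝ³` only.

## Mathlib / tree search

`lean search 'flat norm|FlatNorm|securityRadius|JerrardSeis|VortexFilament'`: no declarations.
Reused: `Literature.Analysis.FluidPDE.curl`, `Literature.Analysis.FluidPDE.IsWeaklyDivFree`
(`VectorCalculus.lean`), Mathlib's `MeasureTheory.MemLp`, `LipschitzWith`, `Function.Periodic`,
the quotient norm on `AddCircle L` (`AddCircle.norm_eq`).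

## References

* R. L. Jerrard, C. Seis, *On the vortex filament conjecture for Euler flows*, ARMA 224 (2017)
  135–172, arXiv:1603.00227 [JerrardSeis2016]: §2.1 (1), (2), (4), (5); §2.4 (12)–(15),
  Theorem 1; §4.3.
-/

noncomputable section

open MeasureTheory Set Function
open scoped InnerProductSpace RealInnerProductSpace ENNReal NNReal

namespace Literature.Analysis.FluidPDE

namespace VortexFilament

/-- Local notation for physical space `ℝ³ = EuclideanSpace ℝ (Fin 3)`. -/
local notation "ℝ³" => EuclideanSpace ℝ (Fin 3)

/-! ### Closed Lipschitz curves parametrised by arclength -/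

/-- `γ : ℝ → ℝ³` is an **arclength parametrisation of a closed oriented Lipschitz curve of length
`L`** (Jerrard–Seis, §2.1: "`Γ` a closed, oriented Lipschitz curve in `ℝ³` of length `L`, and
`γ : ℝ/Lℤ → ℝ³` an arclength parametrization of `Γ`. Thus `|γ'(s)| = 1`"): `L > 0`, `γ` is
`L`-periodic (a map on `ℝ/Lℤ`), `1`-Lipschitz, and has unit speed at almost every parameter
(a Lipschitz map is differentiable only a.e.). Corners and finitely many self-intersections are
allowed. [cite: JerrardSeis2016, §2.1 p.3] -/
structure IsArclengthLoop (L : ℝ) (γ : ℝ → ℝ³) : Prop where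
  /-- The length is positive. -/
  pos : 0 < L
  /-- The parametrisation is `L`-periodic (a map on `ℝ/Lℤ`). -/
  periodic : Function.Periodic γ L
  /-- An arclength parametrisation is `1`-Lipschitz. -/
  lipschitz : LipschitzWith 1 γ
  /-- Unit speed almost everywhere: `|γ'(s)| = 1` for a.e. `s`. -/
  norm_deriv_ae : ∀ᵐ s : ℝ, ‖deriv γ s‖ = 1

/-- The distance on the loop `ℝ/Lℤ`: `loopDist L h = min_{k ∈ ℤ} |h − kL|`, realised as the
quotient norm `‖(h : AddCircle L)‖` (Mathlib's `AddCircle.norm_eq`); the source's convention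
"for `s, t ∈ ℝ/Lℤ`, `|s − t|` means distance modulo `Lℤ`" (p. 3). [cite: JerrardSeis2016, §2.1 p.3] -/
def loopDist (L h : ℝ) : ℝ :=
  ‖((h : ℝ) : AddCircle L)‖

/-- `loopDist` is the explicit `|h − round(h/L) L|`. [folklore] -/
theorem loopDist_eq (L h : ℝ) : loopDist L h = |h - round (L⁻¹ * h) * L| :=
  AddCircle.norm_eq L

/-- `loopDist` is nonnegative. [folklore] -/
theorem loopDist_nonneg (L h : ℝ) : 0 ≤ loopDist L h :=
  norm_nonneg _

/-! ### Security radius, `κ*`, and its weak-`L¹` size -/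

/-- The set of **admissible security radii** of the loop `γ` (period `L`) at the parameter `s`
(Jerrard–Seis, §2.1, eq. (1)): the `r > 0` such that
`|γ(s+h) − γ(s)| ≥ r/2` for all `|h| ≥ r` and `|γ'(s+h) − γ'(s)| ≤ |h|/r` for all `|h| ≤ r`,
`|h|` the loop distance. Here `γ' = deriv γ` (see the module docstring for the a.e. caveat). [cite: JerrardSeis2016, §2.1 eq. (1)] -/
def securityRadii (L : ℝ) (γ : ℝ → ℝ³) (s : ℝ) : Set ℝ :=
  {r : ℝ | 0 < r ∧ (∀ h : ℝ, r ≤ loopDist L h → r / 2 ≤ ‖γ (s + h) - γ s‖) ∧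
    (∀ h : ℝ, loopDist L h ≤ r → ‖deriv γ (s + h) - deriv γ s‖ ≤ loopDist L h / r)}

/-- The **security radius** `r_γ(s) = sup {admissible radii}` of `γ` at `γ(s)`, valued in
`[0, ∞]` (`sup ∅ = 0`), and set to `0` where `γ` is not differentiable at `s`
(Jerrard–Seis, §2.1, eq. (1): "We set `r(s) = 0` if `γ` is not differentiable at `s`"). [cite: JerrardSeis2016, §2.1 eq. (1)] -/
def securityRadius (L : ℝ) (γ : ℝ → ℝ³) (s : ℝ) : ℝ≥0∞ :=
  open scoped Classical in
  if DifferentiableAt ℝ γ s then ⨆ r ∈ securityRadii L γ s, ENNReal.ofReal r else 0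

/-- `κ*_γ(s) = 1 / r_γ(s) ∈ [0, ∞]` (Jerrard–Seis, §2.1, eq. (2); by (3), `κ* ≥ κ = |γ''|` where
the latter is defined), with `1/0 = ∞`. [cite: JerrardSeis2016, §2.1 eq. (2)] -/
def kappaStar (L : ℝ) (γ : ℝ → ℝ³) (s : ℝ) : ℝ≥0∞ :=
  (securityRadius L γ s)⁻¹

/-- The **weak-`L¹` quasinorm over one period** of `f : ℝ/Lℤ → [0, ∞]`:
`sup_{σ} σ · |{s ∈ [0, L) : f(s) ≥ σ}|` (Jerrard–Seis, §2.1, eq. (4) defining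
`‖κ*‖_{L^{1,∞}}`; the level `σ = 0` contributes `0`). [cite: JerrardSeis2016, §2.1 eq. (4)] -/
def weakL1Norm (L : ℝ) (f : ℝ → ℝ≥0∞) : ℝ≥0∞ :=
  ⨆ σ : ℝ≥0, (σ : ℝ≥0∞) * volume {s : ℝ | s ∈ Set.Ico 0 L ∧ (σ : ℝ≥0∞) ≤ f s}

/-- Where `γ` is not differentiable the security radius is `0`. [cite: JerrardSeis2016, §2.1 eq. (1)] -/
theorem securityRadius_of_not_differentiableAt {L : ℝ} {γ : ℝ → ℝ³} {s : ℝ}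
    (h : ¬ DifferentiableAt ℝ γ s) : securityRadius L γ s = 0 := by
  simp [securityRadius, h]

/-- Where `γ` is not differentiable, `κ* = ∞`. [cite: JerrardSeis2016, §2.1 eq. (2)] -/
theorem kappaStar_of_not_differentiableAt {L : ℝ} {γ : ℝ → ℝ³} {s : ℝ}
    (h : ¬ DifferentiableAt ℝ γ s) : kappaStar L γ s = ∞ := by
  simp [kappaStar, securityRadius_of_not_differentiableAt h]

/-- An admissible radius bounds the security radius from below. [cite: JerrardSeis2016, §2.1 eq. (1)] -/
theorem ofReal_le_securityRadius {L : ℝ} {γ : ℝ → ℝ³} {s r : ℝ} (hd : DifferentiableAt ℝ γ s)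
    (hr : r ∈ securityRadii L γ s) : ENNReal.ofReal r ≤ securityRadius L γ s := by
  rw [securityRadius, if_pos hd]
  exact le_iSup₂ (f := fun r _ => ENNReal.ofReal r) r hr

/-- An admissible radius `r` bounds `κ*` from above by `1/r`. [cite: JerrardSeis2016, §2.1 eq. (2)] -/
theorem kappaStar_le_inv_ofReal {L : ℝ} {γ : ℝ → ℝ³} {s r : ℝ} (hd : DifferentiableAt ℝ γ s)
    (hr : r ∈ securityRadii L γ s) : kappaStar L γ s ≤ (ENNReal.ofReal r)⁻¹ :=
  ENNReal.inv_le_inv.2 (ofReal_le_securityRadius hd hr)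

/-- Each level is bounded by the weak-`L¹` quasinorm. [folklore] -/
theorem mul_volume_le_weakL1Norm (L : ℝ) (f : ℝ → ℝ≥0∞) (σ : ℝ≥0) :
    (σ : ℝ≥0∞) * volume {s : ℝ | s ∈ Set.Ico 0 L ∧ (σ : ℝ≥0∞) ≤ f s} ≤ weakL1Norm L f :=
  le_iSup (fun σ : ℝ≥0 => (σ : ℝ≥0∞) * volume {s : ℝ | s ∈ Set.Ico 0 L ∧ (σ : ℝ≥0∞) ≤ f s}) σ

/-- `weakL1Norm L f ≤ K` iff every level is bounded by `K`. [folklore] -/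
theorem weakL1Norm_le_iff {L : ℝ} {f : ℝ → ℝ≥0∞} {K : ℝ≥0∞} :
    weakL1Norm L f ≤ K ↔
      ∀ σ : ℝ≥0, (σ : ℝ≥0∞) * volume {s : ℝ | s ∈ Set.Ico 0 L ∧ (σ : ℝ≥0∞) ≤ f s} ≤ K :=
  iSup_le_iff

/-! ### The measure `μ_Γ` and flat-norm concentration of the vorticity -/

/-- The pairing with the vector-valued measure `μ_Γ` of the loop:
`∫ ξ · dμ_Γ = ∫_Γ ξ · τ_Γ dH¹ = ∫_{ℝ/Lℤ} ξ(γ(s)) · γ'(s) ds`, computed over the period `[0, L)`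
(Jerrard–Seis, §2.1, display defining `μ_Γ` on p. 4). [cite: JerrardSeis2016, §2.1 p.4 (mu_Gamma)] -/
def tangentLineIntegral (L : ℝ) (γ : ℝ → ℝ³) (ξ : ℝ³ → ℝ³) : ℝ :=
  ∫ s in Set.Ico 0 L, ⟪ξ (γ s), deriv γ s⟫_ℝ

/-- The flat pairing of the vorticity defect against a test field:
`∫ ξ · d(∇ × u − μ_Γ) = ∫ u · (∇ × ξ) dx − ∫ ξ · dμ_Γ`, the distributional vorticity `∇ × u` of
`u ∈ L²` paired with `ξ ∈ C¹_c` through `⟨∇ × u, ξ⟩ = ∫ u · ∇ × ξ`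
(Jerrard–Seis, §2.1 eq. (5) with §2.2, Lemma 1: `ω = curl u` "the vorticity (measure)"). [cite: JerrardSeis2016, §2.1 eq. (5)] -/
def vorticityDefectPairing (L : ℝ) (γ : ℝ → ℝ³) (u ξ : ℝ³ → ℝ³) : ℝ :=
  (∫ x, ⟪u x, curl ξ x⟫_ℝ) - tangentLineIntegral L γ ξ

/-- Admissible test fields of the **homogeneous flat norm**
`‖ω‖_F = sup {∫ ξ · dω : ξ ∈ C¹_c(ℝ³; ℝ³), ‖∇ × ξ‖_{L^∞} ≤ 1}` (Jerrard–Seis, §2.1, eq. (5)):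
`ξ` is `C¹`, compactly supported, and `|∇ × ξ(x)| ≤ 1` everywhere. [cite: JerrardSeis2016, §2.1 eq. (5)] -/
def IsFlatTestField (ξ : ℝ³ → ℝ³) : Prop :=
  ContDiff ℝ 1 ξ ∧ HasCompactSupport ξ ∧ ∀ x, ‖curl ξ x‖ ≤ 1

/-- The **flat distance of the vorticity to the curve**, `‖∇ × u − μ_Γ‖_F ∈ [0, ∞]`: the supremum
of `∫ ξ · d(∇ × u − μ_Γ)` over flat test fields (Jerrard–Seis, §2.1, eq. (5); the class of test
fields is symmetric under `ξ ↦ −ξ`, so this is the supremum of the absolute values). [cite: JerrardSeis2016, §2.1 eq. (5)] -/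
def vorticityFlatDist (L : ℝ) (γ : ℝ → ℝ³) (u : ℝ³ → ℝ³) : ℝ≥0∞ :=
  ⨆ (ξ : ℝ³ → ℝ³) (_ : IsFlatTestField ξ), ENNReal.ofReal (vorticityDefectPairing L γ u ξ)

/-- **Flat-norm concentration of the vorticity around the curve** at scale `δ`:
`‖∇ × u − μ_Γ‖_F ≤ δ`, i.e. `∫ u · (∇ × ξ) − ∫ ξ · dμ_Γ ≤ δ` for every flat test field `ξ`
(Jerrard–Seis, §2.4, hypothesis (12) is the case `δ = ε L`). [cite: JerrardSeis2016, §2.4 eq. (12)] -/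
def IsFlatConcentrated (L : ℝ) (γ : ℝ → ℝ³) (u : ℝ³ → ℝ³) (δ : ℝ) : Prop :=
  ∀ ξ : ℝ³ → ℝ³, IsFlatTestField ξ → vorticityDefectPairing L γ u ξ ≤ δ

/-- Monotonicity of flat concentration in the scale. [folklore] -/
theorem IsFlatConcentrated.mono {L : ℝ} {γ : ℝ → ℝ³} {u : ℝ³ → ℝ³} {δ δ' : ℝ}
    (h : IsFlatConcentrated L γ u δ) (hδ : δ ≤ δ') : IsFlatConcentrated L γ u δ' :=
  fun ξ hξ => (h ξ hξ).trans hδ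

/-- For `δ ≥ 0`, flat concentration at scale `δ` is exactly `‖∇ × u − μ_Γ‖_F ≤ δ`. [cite: JerrardSeis2016, §2.1 eq. (5), §2.4 eq. (12)] -/
theorem isFlatConcentrated_iff {L : ℝ} {γ : ℝ → ℝ³} {u : ℝ³ → ℝ³} {δ : ℝ} (hδ : 0 ≤ δ) :
    IsFlatConcentrated L γ u δ ↔ vorticityFlatDist L γ u ≤ ENNReal.ofReal δ := by
  simp only [IsFlatConcentrated, vorticityFlatDist, iSup_le_iff]
  refine forall₂_congr fun ξ _ => ?_
  rw [ENNReal.ofReal_le_ofReal_iff hδ]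

/-! ### Time rescaling, excess, and the energy lower bound -/

/-- The time-rescaling factor `k_ε = 4π / |log(ε/L)|` (Jerrard–Seis, §2.4, display after
(13), p. 7). [cite: JerrardSeis2016, §2.4 p.7 (k_eps)] -/
def timeRescaling (L ε : ℝ) : ℝ :=
  4 * Real.pi / |Real.log (ε / L)|

/-- The **excess** of the kinetic energy of `u` relative to a curve of length `L`:
`Exc_ε(u, Λ) = (k_ε / L) ∫ ½ |u|² dx − 1` (Jerrard–Seis, §2.4, eq. (14)). [cite: JerrardSeis2016, §2.4 eq. (14)] -/
def excess (L ε : ℝ) (u : ℝ³ → ℝ³) : ℝ :=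
  timeRescaling L ε / L * ((1 / 2) * ∫ x, ‖u x‖ ^ 2) - 1

/-- **Jerrard–Seis kinetic-energy lower bound for vorticity concentrated near a curve**
(Theorem 1, p. 8, first assertion, in the unwound form (13), p. 7). There is an absolute constant
`C` such
that: for every closed oriented Lipschitz curve of length `L`, given by an arclength
parametrisation `γ : ℝ/Lℤ → ℝ³` with `‖κ*_γ‖_{L^{1,∞}} ≤ K < ∞`, every `ε ∈ (0, L/2)`, and every
divergence-free `u ∈ L²(ℝ³; ℝ³)` whose vorticity satisfies the flat-norm concentration
`‖∇ × u − μ_Γ‖_F ≤ ε L` (12), one has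
`∫ ½ |u|² dx ≥ L log(L/ε) / (4π) − C K² L`;
equivalently (`filamentEnergyLowerBound_iff_excess`) `0 ≤ Exc_ε(u, Γ) + C K² k_ε`, which is the
printed form "`0 ≤ Exc_ε(u_ε, Γ) + O(‖κ*‖²_{L^{1,∞}} k_ε)`" with the paper's convention that
implicit constants are absolute (§2.1, p. 4). Proof in the source: comparison with the prototype field
`v^ε = ∇ × (−Δ)⁻¹(ρ^ε ∗ μ_Γ)`, `‖v^ε‖²_{L²} = |log ε|/(2π) + O(‖κ*‖²)`, and
`|∫ v^ε · (v^ε − u)| ≲ ‖κ*‖` via the flat-norm duality (§4.3, p. 23). [cite: JerrardSeis2016, Thm 1 p.8 (first assertion) with §2.4 eqs. (12), (13)] -/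
def JerrardSeis2016_filamentEnergyLowerBound : Prop :=
  ∃ C : ℝ, ∀ (L ε : ℝ) (γ : ℝ → ℝ³) (K : ℝ≥0) (u : ℝ³ → ℝ³),
    IsArclengthLoop L γ → weakL1Norm L (kappaStar L γ) ≤ K → 0 < ε → ε < L / 2 →
    MemLp u 2 volume → IsWeaklyDivFree u → IsFlatConcentrated L γ u (ε * L) →
    L * Real.log (L / ε) / (4 * Real.pi) - C * (K : ℝ) ^ 2 * L ≤ (1 / 2) * ∫ x, ‖u x‖ ^ 2

/-- For `0 < ε < L`, `k_ε = 4π / log(L/ε)` and it is positive. [cite: JerrardSeis2016, §2.4 p.7 (k_eps)] -/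
theorem timeRescaling_eq {L ε : ℝ} (hε : 0 < ε) (hεL : ε < L) :
    timeRescaling L ε = 4 * Real.pi / Real.log (L / ε) ∧ 0 < timeRescaling L ε := by
  have hL : 0 < L := hε.trans hεL
  have hlog : Real.log (ε / L) = -Real.log (L / ε) := by
    rw [← Real.log_inv, inv_div]
  have hpos : 0 < Real.log (L / ε) := Real.log_pos ((one_lt_div hε).2 hεL)
  have habs : |Real.log (ε / L)| = Real.log (L / ε) := by
    rw [hlog, abs_neg, abs_of_pos hpos]
  refine ⟨by rw [timeRescaling, habs], ?_⟩
  rw [timeRescaling, habs]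
  positivity

/-- The recorded energy form is equivalent to the printed excess form of Theorem 1:
`∫ ½|u|² ≥ L log(L/ε)/(4π) − C K² L` iff `0 ≤ Exc_ε(u, Γ) + C K² k_ε` (multiply by
`k_ε / L > 0`). [cite: JerrardSeis2016, Thm 1 p.8 (first assertion), eqs. (13), (14)] -/
theorem energy_lower_bound_iff_excess {L ε C : ℝ} {K : ℝ≥0} {u : ℝ³ → ℝ³} (hε : 0 < ε)
    (hεL : ε < L) :
    L * Real.log (L / ε) / (4 * Real.pi) - C * (K : ℝ) ^ 2 * L ≤ (1 / 2) * ∫ x, ‖u x‖ ^ 2 ↔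
      0 ≤ excess L ε u + C * (K : ℝ) ^ 2 * timeRescaling L ε := by
  have hL : 0 < L := hε.trans hεL
  obtain ⟨hk, hkpos⟩ := timeRescaling_eq hε hεL
  have hlog : 0 < Real.log (L / ε) := Real.log_pos ((one_lt_div hε).2 hεL)
  set E : ℝ := (1 / 2) * ∫ x, ‖u x‖ ^ 2 with hE
  rw [excess, hk]
  rw [hk] at hkpos
  constructor
  · intro h
    -- `0 ≤ (k/L) E - 1 + C K² k` is `(k/L) · (E - (L/k - C K² L)) ≥ 0`
    have key : 4 * Real.pi / Real.log (L / ε) / L * E - 1 +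
        C * (K : ℝ) ^ 2 * (4 * Real.pi / Real.log (L / ε)) =
        (4 * Real.pi / Real.log (L / ε) / L) *
          (E - (L * Real.log (L / ε) / (4 * Real.pi) - C * (K : ℝ) ^ 2 * L)) := by
      field_simp
      ring
    rw [key]
    exact mul_nonneg (by positivity) (sub_nonneg.2 h)
  · intro h
    have key : 4 * Real.pi / Real.log (L / ε) / L * E - 1 +
        C * (K : ℝ) ^ 2 * (4 * Real.pi / Real.log (L / ε)) =
        (4 * Real.pi / Real.log (L / ε) / L) *
          (E - (L * Real.log (L / ε) / (4 * Real.pi) - C * (K : ℝ) ^ 2 * L)) := by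
      field_simp
      ring
    rw [key] at h
    have hc : 0 < 4 * Real.pi / Real.log (L / ε) / L := by positivity
    exact sub_nonneg.1 ((mul_nonneg_iff_of_pos_left hc).1 h)

/-- **Printed form of Theorem 1 (first assertion).** The energy lower bound is equivalent to:
there is an absolute `C` with `0 ≤ Exc_ε(u, Γ) + C ‖κ*‖²_{L^{1,∞}} k_ε` under the hypotheses of
Theorem 1. [cite: JerrardSeis2016, Thm 1 p.8 (first assertion)] -/
theorem filamentEnergyLowerBound_iff_excess :
    JerrardSeis2016_filamentEnergyLowerBound ↔
      ∃ C : ℝ, ∀ (L ε : ℝ) (γ : ℝ → ℝ³) (K : ℝ≥0) (u : ℝ³ → ℝ³),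
        IsArclengthLoop L γ → weakL1Norm L (kappaStar L γ) ≤ K → 0 < ε → ε < L / 2 →
        MemLp u 2 volume → IsWeaklyDivFree u → IsFlatConcentrated L γ u (ε * L) →
        0 ≤ excess L ε u + C * (K : ℝ) ^ 2 * timeRescaling L ε := by
  refine exists_congr fun C => ?_
  refine forall₅_congr fun L ε γ K u => ?_
  refine forall₄_congr fun hγ _ hε hεL => ?_
  have hεL' : ε < L := hεL.trans (half_lt_self hγ.pos)
  refine forall₃_congr fun _ _ _ => ?_
  exact energy_lower_bound_iff_excess hε hεL'

end VortexFilament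

end Literature.Analysis.FluidPDE
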